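import Mathlib.RingTheory.Polynomial.Resultant.Basic
import Mathlib.RingTheory.LocalRing.ResidueField.Basic
import Mathlib.LinearAlgebra.Charpoly.Basic
import Mathlib.Algebra.MonoidAlgebra.Basic
import HarnessLib

/-!
# Skinner–Urban 2014, Lemma 4.1.3: orthogonal idempotents in `B[G]` for residually disjoint
# representations (the first lemma of §4, "Constructing cocycles")

C. Skinner, E. Urban, *The Iwasawa main conjectures for `GL₂`*, Invent. Math. 195 (2014), 1–277
(bib key `SkinnerUrban2014`; held author version `paper:doi-10-1007-s00222-013-0448-1`, whose
three-level numbering and pages are used in every `[cite:]` of the tree for this source).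

**§4.1.1–4.1.3, as printed** (p. 48 of the held text). "4.1.1. *Representations.* Let `G` be a
group and `C` a ring. A `C`-representation of `G` is a pair `(V, r)` consisting of a finite
`C`-module `V` and a homomorphism `r : G → Aut_C(V)`. This extends by `C`-linearity to a
homomorphism `r : C[G] → End_C(V)` … If `V ≅ Cⁿ` then we can define `tr r(x), det r(x) ∈ C` for any
`x ∈ C[G]`. In particular we can define the characteristic polynomial of `x`,
`Ch(r, x, T) := det(id − T · r(x)) ∈ C[T]`. We say that `r` is defined over a subring `B` of `C` if
`Ch(r, x, T) ∈ B[T]` for all `x ∈ G`. … 4.1.2. *Residually disjoint representations.* Let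
`(V₁, σ₁)` and `(V₂, σ₂)` be `C`-representations of a group `G` with each `V_i` free over `C`.
Assume both are defined over a local henselian subring `B ⊆ C`. We say that `σ₁` and `σ₂` are
residually disjoint modulo the maximal ideal `𝔪_B` of `B` … if there exists `x ∈ B[G]` such that
`Ch(σ₁, x, T) mod 𝔪_B` and `Ch(σ₂, x, T) mod 𝔪_B` are relatively prime in `κ_B[T]`, where
`κ_B := B/𝔪_B`. **Lemma 4.1.3.** Suppose `(V₁, σ₁)` and `(V₂, σ₂)` as above are residually disjoint.
Then there exists `x₁, x₂ ∈ B[G]` such that for `i, j ∈ {1, 2}`, `x_i` acts as the identity on `V_j`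
if `i = j` and annihilates `V_j` if `i ≠ j`. *Proof.* Let `x ∈ B[G]` be such that `Ch(σ₁, x, T) mod
𝔪_B` and `Ch(σ₂, x, T) mod 𝔪_B` are relatively prime in `κ_B[T]`. By Hensel's lemma there exist
`Q₁, Q₂ ∈ B[T]` such that `Q₁(T)Ch(σ₁, x, T) + Q₂(T)Ch(σ₂, x, T) = 1`. Put
`x₁ := Q₂(x)Ch(σ₂, x, x)` and `x₂ := Q₁(x)Ch(σ₁, x, x)`. We have `x₁ + x₂ = 1`, and for `i ≠ j`, `x_i`
acts trivially on `V_j` by the Cayley identity."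

**Reading note (recorded, with a one-line witness).** The proof's "Cayley identity" is the
Cayley–Hamilton theorem `P(σ(x)) = 0` for the MONIC characteristic polynomial
`P(T) = det(T·id − σ(x))`; for the reversed polynomial `Ch(σ, x, T) = det(id − T·σ(x))` of 4.1.1
one has instead `Ch(σ, x, σ(x)) = id` whenever `σ(x) = 0`, and Lemma 4.1.3 read literally with
`Ch` fails: `G = 1`, `B = C = κ` a field, `V₁ = V₂ = κ` with the trivial action, `x = 0 ∈ B[G] = κ`
— then `Ch(σ₁, 0, T) = Ch(σ₂, 0, T) = 1` are relatively prime, yet no `x₁ ∈ κ` is `1` on `V₁` and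
`0` on `V₂`. (For `x ∈ G`, where `σ_i(x)` is invertible, the two readings agree after `T ↦ x⁻¹`.)
This file therefore PROVES Lemma 4.1.3 in the form its proof establishes — with the monic
characteristic polynomials — and in the generality the proof actually uses:

* `isCoprime_of_monic_of_isCoprime_map_residue` — the step "there exist `Q₁, Q₂ ∈ B[T]` such
  that `Q₁P₁ + Q₂P₂ = 1`": for `B` LOCAL (Henselian is not needed) and `P₁` monic, coprimality of
  `P₁ mod 𝔪_B`, `P₂ mod 𝔪_B` in `κ_B[T]` lifts to `B[T]` (the resultant `Res(P₁, P₂) ∈ B` reduces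
  to `Res(P̄₁, P̄₂) ∈ κ_B^×`, Mathlib `Polynomial.isUnit_resultant_iff_isCoprime`, and units lift
  along the local map `B → κ_B`).
* `exists_orthogonal_idempotents_of_isCoprime_map_residue` — **Lemma 4.1.3, algebra form**: `B`
  local, `S` any `B`-algebra (e.g. `B[G]`, not necessarily commutative), `σ_i : S → E_i`
  `B`-algebra maps (e.g. `E_i = End_C(V_i)`), `x ∈ S`, `P_i ∈ B[T]` with `P₁` monic,
  `P_i(σ_i(x)) = 0` (Cayley–Hamilton, "defined over `B`") and `P̄₁, P̄₂` coprime ⟹ there are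
  `x₁, x₂ ∈ S` (polynomials in `x`), `x₁ + x₂ = 1`, `σ_i(x_i) = 1`, `σ_j(x_i) = 0` (`i ≠ j`) —
  the printed construction `x₁ := Q₂(x)P₂(x)`, `x₂ := Q₁(x)P₁(x)`.
* `exists_orthogonal_idempotents_monoidAlgebra` — the printed dress with `C = B`: `G` a monoid,
  `V₁, V₂` finite free `B`-modules with `B[G]`-actions `σ_i : B[G] →ₐ[B] End_B(V_i)`, and `x ∈ B[G]`
  whose characteristic polynomials `det(T − σ_i(x))` are coprime modulo `𝔪_B` (Mathlib's
  `LinearMap.charpoly`, Cayley–Hamilton `LinearMap.aeval_self_charpoly`). The case `C ⊋ B` is the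
  algebra form with `E_i = End_C(V_i)` and `P_i ∈ B[T]` the descended characteristic polynomials.

Theorems only (no `def`, no named fact; D-0014/D-0026). No consumer in the tree today (the cell
`b2b-bsdres` works with Greenberg–Vatsal congruences at Eisenstein primes, not with the §4 lattice
construction); filed as the algebraic entry point of §4 with the reading note above.

## References

* C. Skinner, E. Urban, Invent. Math. 195 (2014), §4.1.1–4.1.3, Lemma 4.1.3 and its proof
  (p. 48 of the author version). [SkinnerUrban2014]
-/

noncomputable section

open Polynomial

namespace Literature.NumberTheory.EllipticCurves.SkinnerUrban2014

universe u v w w'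

variable {B : Type u} [CommRing B] [IsLocalRing B]

/-- **"By Hensel's lemma there exist `Q₁, Q₂ ∈ B[T]` such that `Q₁(T)P₁(T) + Q₂(T)P₂(T) = 1`"**
(proof of Lemma 4.1.3), for a LOCAL ring `B` and `P₁` monic: if `P₁ mod 𝔪_B` and `P₂ mod 𝔪_B` are
relatively prime in `κ_B[T]` then `P₁, P₂` are coprime in `B[T]`. Proof via the resultant:
`Res(P₁,P₂) mod 𝔪_B = Res(P̄₁, P̄₂)` (up to the harmless degree padding of `P̄₂`, `P̄₁` being monic)
is a unit by coprimality over the field `κ_B`, so `Res(P₁, P₂) ∈ B^×`, which for monic `P₁` is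
equivalent to coprimality. [cite: SkinnerUrban2014, Lemma 4.1.3, proof (p. 48)] -/
theorem isCoprime_of_monic_of_isCoprime_map_residue {P₁ P₂ : B[X]} (hP₁ : P₁.Monic)
    (h : IsCoprime (P₁.map (IsLocalRing.residue B)) (P₂.map (IsLocalRing.residue B))) :
    IsCoprime P₁ P₂ := by
  set φ := IsLocalRing.residue B
  have hP₁bar : (P₁.map φ).Monic := hP₁.map φ
  have hdeg₁ : (P₁.map φ).natDegree = P₁.natDegree := hP₁.natDegree_map φ
  obtain ⟨k, hk⟩ := Nat.exists_eq_add_of_le (natDegree_map_le (p := P₂) (f := φ))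
  -- unit resultant over the residue field, at the padded degrees `(deg P₁, deg P₂)`
  have h1 : IsUnit (resultant (P₁.map φ) (P₂.map φ)) :=
    (isUnit_resultant_iff_isCoprime hP₁bar).mpr h
  have h2 : IsUnit (resultant (P₁.map φ) (P₂.map φ) P₁.natDegree P₂.natDegree) := by
    rw [hk, ← hdeg₁, resultant_add_right_deg _ _ _ _ k le_rfl]
    have hc : (P₁.map φ).coeff (P₁.map φ).natDegree = 1 := hP₁bar.leadingCoeff
    rw [hc, one_pow, one_mul]
    exact h1
  -- lift the unit along the local homomorphism `B → κ_B`
  rw [resultant_map_map] at h2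
  exact (isUnit_resultant_iff_isCoprime hP₁).mp ((isUnit_map_iff φ _).mp h2)

/-- **Skinner–Urban 2014, Lemma 4.1.3 (algebra form, with the monic characteristic polynomials the
proof uses).** Let `B` be a local ring, `S` a `B`-algebra (in the paper `S = B[G]`), `σ₁ : S → E₁`,
`σ₂ : S → E₂` maps of `B`-algebras (in the paper `E_i = End_C(V_i)`), and `x ∈ S`. Suppose
`P₁, P₂ ∈ B[T]`, `P₁` monic, annihilate `σ₁(x)`, `σ₂(x)` respectively ("the Cayley identity" for
representations defined over `B`) and are relatively prime modulo `𝔪_B` ("residually disjoint").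
Then there exist `x₁, x₂ ∈ S` with `x₁ + x₂ = 1` such that `x_i` acts as the identity through `σ_i`
and as zero through `σ_j`, `j ≠ i` — namely `x₁ := Q₂(x)P₂(x)`, `x₂ := Q₁(x)P₁(x)` for
`Q₁P₁ + Q₂P₂ = 1`. [cite: SkinnerUrban2014, Lemma 4.1.3 (p. 48)] -/
theorem exists_orthogonal_idempotents_of_isCoprime_map_residue
    {S : Type v} [Ring S] [Algebra B S]
    {E₁ : Type w} [Ring E₁] [Algebra B E₁] {E₂ : Type w'} [Ring E₂] [Algebra B E₂]
    (σ₁ : S →ₐ[B] E₁) (σ₂ : S →ₐ[B] E₂) (x : S) {P₁ P₂ : B[X]} (hP₁ : P₁.Monic)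
    (h₁ : aeval (σ₁ x) P₁ = 0) (h₂ : aeval (σ₂ x) P₂ = 0)
    (hcop : IsCoprime (P₁.map (IsLocalRing.residue B)) (P₂.map (IsLocalRing.residue B))) :
    ∃ x₁ x₂ : S, x₁ + x₂ = 1 ∧ σ₁ x₁ = 1 ∧ σ₂ x₁ = 0 ∧ σ₁ x₂ = 0 ∧ σ₂ x₂ = 1 := by
  obtain ⟨Q₁, Q₂, hQ⟩ := isCoprime_of_monic_of_isCoprime_map_residue hP₁ hcop
  -- `x₁ := Q₂(x) P₂(x)`, `x₂ := Q₁(x) P₁(x)`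
  refine ⟨aeval x (Q₂ * P₂), aeval x (Q₁ * P₁), ?_, ?_, ?_, ?_, ?_⟩
  · rw [← map_add, add_comm, hQ, map_one]
  · -- on `E₁`: `x₁ = 1 - x₂` and `x₂ ↦ Q₁(σ₁ x) P₁(σ₁ x) = 0`
    have hx : aeval x (Q₂ * P₂) = 1 - aeval x (Q₁ * P₁) := by
      rw [eq_sub_iff_add_eq, add_comm, ← map_add, hQ, map_one]
    rw [hx, map_sub, map_one, ← aeval_algHom_apply, map_mul, h₁, mul_zero, sub_zero]
  · rw [← aeval_algHom_apply, map_mul, h₂, mul_zero]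
  · rw [← aeval_algHom_apply, map_mul, h₁, mul_zero]
  · have hx : aeval x (Q₁ * P₁) = 1 - aeval x (Q₂ * P₂) := by
      rw [eq_sub_iff_add_eq, ← map_add, hQ, map_one]
    rw [hx, map_sub, map_one, ← aeval_algHom_apply, map_mul, h₂, mul_zero, sub_zero]

/-- **Skinner–Urban 2014, Lemma 4.1.3, for `B[G]`-representations on finite free `B`-modules**
(the printed dress with `C = B`; Cayley–Hamilton supplied by Mathlib). Let `B` be a local ring,
`G` a monoid, `V₁, V₂` finite free `B`-modules with actions `σ_i : B[G] → End_B(V_i)`, and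
`x ∈ B[G]` such that the characteristic polynomials `det(T − σ₁(x))`, `det(T − σ₂(x))` are
relatively prime modulo `𝔪_B` (residual disjointness, monic reading). Then there are
`x₁, x₂ ∈ B[G]` with `x₁ + x₂ = 1`, `σ_i(x_i) = id`, `σ_j(x_i) = 0` for `i ≠ j`.
[cite: SkinnerUrban2014, Lemma 4.1.3 (p. 48)] -/
theorem exists_orthogonal_idempotents_monoidAlgebra (G : Type v) [Monoid G]
    {V₁ : Type w} [AddCommGroup V₁] [Module B V₁] [Module.Free B V₁] [Module.Finite B V₁]
    {V₂ : Type w'} [AddCommGroup V₂] [Module B V₂] [Module.Free B V₂] [Module.Finite B V₂]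
    (σ₁ : MonoidAlgebra B G →ₐ[B] Module.End B V₁) (σ₂ : MonoidAlgebra B G →ₐ[B] Module.End B V₂)
    (x : MonoidAlgebra B G)
    (hcop : IsCoprime ((σ₁ x).charpoly.map (IsLocalRing.residue B))
      ((σ₂ x).charpoly.map (IsLocalRing.residue B))) :
    ∃ x₁ x₂ : MonoidAlgebra B G,
      x₁ + x₂ = 1 ∧ σ₁ x₁ = 1 ∧ σ₂ x₁ = 0 ∧ σ₁ x₂ = 0 ∧ σ₂ x₂ = 1 :=
  exists_orthogonal_idempotents_of_isCoprime_map_residue σ₁ σ₂ x (σ₁ x).charpoly_monic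
    (σ₁ x).aeval_self_charpoly (σ₂ x).aeval_self_charpoly hcop

end Literature.NumberTheory.EllipticCurves.SkinnerUrban2014

end
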